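import Summits.KontsevichZagierPeriods.Zeta5Search.TwoTaleLineBoundBlocks

/-!
# Line-bound bricks: scaling `y = nη`, `v = nV` and the `η`-derivative of the primitive

HONEST FRAMING: systematic search; no irrationality claim unless certified.

Cell pub-zeta5, T3 service (P1 g9) for E5 (`families/denom/P15KERNEL.md` §6.1): after `log_norm_ratRC_le` /
`log_norm_RC_le` the bound is a signed sum of `prim y (u + c n)` and `halfLog y (u + c n)`; with `y = nη`, `u + cn = nV`:
* `halfLog_scale : halfLog (nη) (nV) = log n + halfLog η V`;
* `prim_scale : prim (nη) (nV) = n · prim η V + nV · log n` — so the `n log n` terms are `(Σ±V)·n log n` (degree balance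
  against Stirling) and the rate function is `h(ξ,η) = Σ± prim η Vᵢ + const − 2π|η|` with `prim η V = V·½log(V²+η²) − V +
  η·arctan(V/η)` (= fam-denom's `F`);
* `hasDerivAt_prim_eta : ∂/∂η prim η V = arctan(V/η)` (`η ≠ 0`) and `|∂/∂η prim η V| ≤ π/2` — the Lipschitz constant of the
  `η`-certificate (`Σᵢ|·| ≤ 8·π/2`).
-/

noncomputable section

open Real

namespace Summit.KontsevichZagierPeriods.Zeta5Search.TwoTaleLineBound

/-- `½log((nV)² + (nη)²) = log n + ½log(V²+η²)` (`n > 0`, `(V,η) ≠ 0`). -/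
theorem halfLog_scale {n : ℝ} (hn : 0 < n) {η : ℝ} (hη : η ≠ 0) (V : ℝ) :
    halfLog (n * η) (n * V) = Real.log n + halfLog η V := by
  unfold halfLog
  have hpos : 0 < V ^ 2 + η ^ 2 := by positivity
  rw [show (n * V) ^ 2 + (n * η) ^ 2 = n ^ 2 * (V ^ 2 + η ^ 2) by ring, Real.log_mul (by positivity) hpos.ne',
    Real.log_pow]
  push_cast
  ring

/-- **Scaling of the primitive**: `prim (nη) (nV) = n·prim η V + nV·log n` (`n > 0`, `η ≠ 0`). -/
theorem prim_scale {n : ℝ} (hn : 0 < n) {η : ℝ} (hη : η ≠ 0) (V : ℝ) :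
    prim (n * η) (n * V) = n * prim η V + n * V * Real.log n := by
  have h := halfLog_scale hn hη V
  unfold halfLog at h
  unfold prim
  rw [h, mul_div_mul_left V η hn.ne']
  ring

/-- **`∂/∂η prim η V = arctan(V/η)`** for `η ≠ 0` (the `V·η/(V²+η²)` terms cancel). -/
theorem hasDerivAt_prim_eta {η : ℝ} (hη : η ≠ 0) (V : ℝ) :
    HasDerivAt (fun η => prim η V) (Real.arctan (V / η)) η := by
  have hpos : 0 < V ^ 2 + η ^ 2 := by positivity
  have h1 : HasDerivAt (fun η : ℝ => V ^ 2 + η ^ 2) (2 * η) η := by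
    simpa using (hasDerivAt_pow 2 η).const_add (V ^ 2)
  have h2 : HasDerivAt (fun η : ℝ => V * (Real.log (V ^ 2 + η ^ 2) / 2)) (V * (2 * η / (V ^ 2 + η ^ 2) / 2)) η :=
    ((h1.log hpos.ne').div_const 2).const_mul V
  have h3 : HasDerivAt (fun η : ℝ => V / η) (-V / η ^ 2) η := by
    have := (hasDerivAt_inv hη).const_mul V
    simpa [div_eq_mul_inv] using this
  have h4 : HasDerivAt (fun η : ℝ => η * Real.arctan (V / η))
      (1 * Real.arctan (V / η) + η * (1 / (1 + (V / η) ^ 2) * (-V / η ^ 2))) η := (hasDerivAt_id η).mul h3.arctan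
  have h : HasDerivAt (fun η => prim η V)
      (V * (2 * η / (V ^ 2 + η ^ 2) / 2) + (1 * Real.arctan (V / η) + η * (1 / (1 + (V / η) ^ 2) * (-V / η ^ 2)))) η :=
    (h2.sub_const V).add h4
  refine h.congr_deriv ?_
  field_simp
  ring

/-- `|∂/∂η prim η V| ≤ π/2`. -/
theorem abs_deriv_prim_eta_le (η V : ℝ) : |Real.arctan (V / η)| ≤ π / 2 :=
  (abs_lt.2 ⟨Real.neg_pi_div_two_lt_arctan _, Real.arctan_lt_pi_div_two _⟩).le

/-- `prim η V` is even in `η`. -/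
theorem prim_neg_eta (η V : ℝ) : prim (-η) V = prim η V := by
  unfold prim
  rw [neg_sq, div_neg, Real.arctan_neg]
  ring

end Summit.KontsevichZagierPeriods.Zeta5Search.TwoTaleLineBound

end
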